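import Summits.Ventures.HSemireg.WedgeCarrierVacuum

/-!
# Venture HSemireg — the carrier bridge — every coefficient sequence (Ecl, gw, Φ_gw)

HONEST FRAMING. Part of the Lean index of the computation cell `pub-hsemireg` (seat p3; Sunday enclosure of the
FORMULA-N kernel assets of seats th-7 / th-6, ENCLOSURE-PLAN-p3.md).  Finite-dimensional exterior algebra over a field ONLY:
no variety, no cohomology theory, no semiregularity map is constructed here; nothing here says that HC / HC_CM / HC_AV holds;
no Literature fact is declared or used.  The geometric DICTIONARY (why these ranks are the `HT`-side box ranks of the cell's
STRUCTURE.md §1 / theory/FORMULA-N.md) lives in theory/FORMULA-N-th7.md PART B §A.3 / §N and is NOT asserted in Lean.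

th-7's ASSEMBLY, file 3 of 4 (theory/th7/WedgeC15.lean v1.4 sha256/16 45d63ee04200ecae (th-7 g3, 17:55Z; PART III = l.2277–2921), the `HSemiregBridge` addendum l.2642–2804,
VERBATIM up to namespaces, MINUS the homogeneity lemmas `gprod_mem` / `expSum_mem` / `pointPair_mem` that p4's GLUE file `WedgeCarrierGlue.lean` carries —
th-7's 17:47:10Z dedup resolution; `gw_mem` kept): C15 FOR EVERY COEFFICIENT SEQUENCE on the bridge side — `LM k = ℓ_k ∧ m_k`, the `q`-weighted layers
`Ecl q k = Σ_{S ⊆ [k]} q_{|S|} Π_{a∈S} ℓ_a ∧ m_a` (= `Σ_m q_m Θ_k^m/m!` without division), the generator `gw` (`gw q (k+1) = gw q k · y_k + gw (σq) k · x_k`),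
`contract_LM`, `LM_mem`, `ρY_LM` / `ρX_LM` / `ρgw_LM` (generators pass `ℓ_j ∧ m_j`), LEMMA A `ρ_gw_vac : ρ(gw q k)(ω_k) = Ecl q k` (sign-free), `Φ_gw`,
the q-linearity `Ecl_add` / `Ecl_smul`, `Ecl_pow : Ecl (λ^·) k = Eprod λ k`, `Ecl_expSum` (so the general law subsumes the exponential-sum law), `gw_mem`,
`finrank_S_Ecl : dim S_k(Ecl q n) = dim range(θ ↦ θ ∧ gw q n)`.  Imports the bridge only (no Hankel file).
-/

open Module

namespace Summit.Ventures.HSemireg.WedgeBridge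

open Module CliffordAlgebra ExteriorAlgebra
open Summit.Ventures.HSemireg.ContractionSpan

variable {K : Type*} [Field K] {n : ℕ} {V : Type*} [AddCommGroup V] [Module K V] (bV : Basis (Fin (n + n)) K V)

/-- `LM k = ℓ_k ∧ m_k` (junk `0` for `k ≥ n`). -/
noncomputable def LM (k : ℕ) : ExteriorAlgebra K V := ι K (ℓN bV k) * ι K (mN bV k)

/-- the `q`-weighted elementary layers `Ecl q k = Σ_{S ⊆ [k]} q_{|S|} · Π_{a ∈ S} ℓ_a ∧ m_a` (`= Σ_m q_m Θ_k^m/m!` in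
characteristic `0`), via `Ecl q (k+1) = Ecl q k + (ℓ_k ∧ m_k) · Ecl (σq) k`, `σq = (q_1, q_2, …)`. -/
noncomputable def Ecl : (ℕ → K) → ℕ → ExteriorAlgebra K V
  | q, 0 => algebraMap K _ (q 0)
  | q, k + 1 => Ecl q k + LM bV k * Ecl (fun j => q (j + 1)) k

/-- the bridge-side Hankel generator: `gw q (k+1) = gw q k · y_k + gw (σq) k · x_k` (HankelRank's `w` with `x ↔ y`). -/
noncomputable def gw : (ℕ → K) → ℕ → ExteriorAlgebra K (W K (Lsp bV))
  | q, 0 => algebraMap K _ (q 0)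
  | q, k + 1 => gw q k * YN bV k + gw (fun j => q (j + 1)) k * XN bV k

/-- `θ_a ⌟ (ℓ_k ∧ m_k) = 0` for `a ≠ k`. -/
lemma contract_LM {a k : ℕ} (ha : a < n) (hk : k < n) (hak : a ≠ k) : contractLeft (θN bV a) (LM bV k) = 0 := by
  rw [LM, CliffordAlgebra.contractLeft_ι_mul, CliffordAlgebra.contractLeft_ι, θN, dif_pos ha, ℓN, dif_pos hk, mN,
    dif_pos hk, θ_ℓ, zero_smul, zero_sub, θ_m,
    if_neg (by intro h; have := congrArg Fin.val h; simp at this; omega), map_zero, mul_zero, neg_zero]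

/-- `ℓ_k ∧ m_k` lies in the even part of the exterior algebra. -/
lemma LM_mem (k : ℕ) : LM bV k ∈ evenFactorAlg (K := K) (⊤ : Submodule K V) :=
  ι_mul_ι_mem_evenFactorAlg Submodule.mem_top Submodule.mem_top

/-- `y_a` and `x_a` pass the even, `θ_a`-closed factor `ℓ_k ∧ m_k` (`a ≠ k`). -/
lemma ρY_LM {a k : ℕ} (hk : k < n) (hak : a ≠ k) (z : ExteriorAlgebra K V) :
    ρ K (Lsp bV) (YN bV a) (LM bV k * z) = LM bV k * ρ K (Lsp bV) (YN bV a) z := by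
  by_cases ha : a < n
  · rw [YN, dif_pos ha, ρ_Yg, ρ_Yg, contractLeft_mul_of_mem_evenFactorAlg _ (LM_mem bV k)]
    have : contractLeft (θ bV ⟨a, ha⟩) (LM bV k) = 0 := by
      have := contract_LM bV ha hk hak; rwa [θN, dif_pos ha] at this
    rw [this, zero_mul, zero_add]
  · rw [YN, dif_neg ha, map_zero, LinearMap.zero_apply, LinearMap.zero_apply, mul_zero]

/-- `ρ(x_a)` commutes past the even factor `ℓ_k ∧ m_k`. -/
lemma ρX_LM {a k : ℕ} (z : ExteriorAlgebra K V) :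
    ρ K (Lsp bV) (XN bV a) (LM bV k * z) = LM bV k * ρ K (Lsp bV) (XN bV a) z := by
  by_cases ha : a < n
  · rw [XN, dif_pos ha, ρ_Xg, ρ_Xg, ← mul_assoc, ← (commute_of_mem_evenFactorAlg (LM_mem bV k) (ι K (ℓ bV ⟨a, ha⟩))).eq,
      mul_assoc]
  · rw [XN, dif_neg ha, map_zero, LinearMap.zero_apply, LinearMap.zero_apply, mul_zero]

/-- the whole `gw q k` passes `ℓ_j ∧ m_j` for `j ≥ k`. -/
lemma ρgw_LM {j : ℕ} (hj : j < n) :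
    ∀ {k : ℕ} (q : ℕ → K), k ≤ j → ∀ z, ρ K (Lsp bV) (gw bV q k) (LM bV j * z) = LM bV j * ρ K (Lsp bV) (gw bV q k) z := by
  intro k
  induction k with
  | zero =>
    intro q _ z
    rw [gw, Algebra.algebraMap_eq_smul_one, map_smul, map_one (ρ K (Lsp bV)), LinearMap.smul_apply,
      LinearMap.smul_apply, Module.End.one_apply, Module.End.one_apply, mul_smul_comm]
  | succ k ih =>
    intro q hk z
    rw [gw, map_add, map_mul (ρ K (Lsp bV)), map_mul (ρ K (Lsp bV)), LinearMap.add_apply, LinearMap.add_apply,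
      Module.End.mul_apply, Module.End.mul_apply, Module.End.mul_apply, Module.End.mul_apply,
      ρY_LM bV hj (by omega), ρX_LM bV, ih q (by omega), ih _ (by omega), mul_add]

/-- **LEMMA A for general `q` (sign-free):** `ρ(gw q k)(m_{k-1} ∧ ⋯ ∧ m_0) = Ecl q k`. -/
theorem ρ_gw_vac : ∀ {k : ℕ} (q : ℕ → K), k ≤ n → ρ K (Lsp bV) (gw bV q k) (vac bV k) = Ecl bV q k := by
  intro k
  induction k with
  | zero =>
    intro q _
    rw [gw, vac, Ecl, Algebra.algebraMap_eq_smul_one, Algebra.algebraMap_eq_smul_one, map_smul,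
      map_one (ρ K (Lsp bV)), LinearMap.smul_apply, Module.End.one_apply]
  | succ k ih =>
    intro q hk
    have hk' : k < n := by omega
    have hY : ρ K (Lsp bV) (YN bV k) (vac bV (k + 1)) = vac bV k := by
      rw [YN, dif_pos hk', ρ_Yg, vac, CliffordAlgebra.contractLeft_ι_mul]
      have h1 : θ bV ⟨k, hk'⟩ (mN bV k) = 1 := by rw [mN, dif_pos hk', θ_m, if_pos rfl]
      have h2 : contractLeft (θ bV ⟨k, hk'⟩) (vac bV k) = 0 := by
        have := contract_vac bV hk' (le_refl k); rwa [θN, dif_pos hk'] at this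
      rw [h1, one_smul, h2, mul_zero, sub_zero]
    have hX : ρ K (Lsp bV) (XN bV k) (vac bV (k + 1)) = LM bV k * vac bV k := by
      rw [XN, dif_pos hk', ρ_Xg, vac, LM, ℓN, dif_pos hk', mul_assoc]
    rw [gw, map_add, map_mul (ρ K (Lsp bV)), map_mul (ρ K (Lsp bV)), LinearMap.add_apply, Module.End.mul_apply,
      Module.End.mul_apply, hY, hX, ρgw_LM bV hk' _ (le_refl k), ih q (by omega), ih _ (by omega), Ecl]

/-- `Φ_ω(gw q n) = Ecl q n = v(q)`: EVERY coefficient sequence is reached from the bridge side. -/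
theorem Φ_gw (q : ℕ → K) : Φ K (Lsp bV) (vacuum bV) (gw bV q n) = Ecl bV q n := by
  rw [Φ_apply, vacuum]
  exact ρ_gw_vac bV q (le_refl n)

/-- `Ecl` is additive in `q`. -/
lemma Ecl_add : ∀ (k : ℕ) (q q' : ℕ → K), Ecl bV (fun j => q j + q' j) k = Ecl bV q k + Ecl bV q' k
  | 0, q, q' => by simp only [Ecl, map_add]
  | k + 1, q, q' => by
    have hs : (fun j => q (j + 1) + q' (j + 1)) = fun j => (fun i => q (i + 1)) j + (fun i => q' (i + 1)) j := rfl
    rw [Ecl, Ecl, Ecl, Ecl_add k q q', hs, Ecl_add k, mul_add]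
    abel

/-- `Ecl` is homogeneous in `q`. -/
lemma Ecl_smul : ∀ (k : ℕ) (c : K) (q : ℕ → K), Ecl bV (fun j => c * q j) k = c • Ecl bV q k
  | 0, c, q => by rw [Ecl, Ecl, map_mul, Algebra.algebraMap_eq_smul_one c, smul_one_mul]
  | k + 1, c, q => by
    have hs : (fun j => c * q (j + 1)) = fun j => c * (fun i => q (i + 1)) j := rfl
    rw [Ecl, Ecl, Ecl_smul k c q, hs, Ecl_smul k c, smul_add, mul_smul_comm]

/-- the exponential sequence: `Ecl (λ^·) k = Π_{a<k} (1 + λ ℓ_a ∧ m_a) = Eprod λ k` — so `finrank_S_Ecl_eq_hankel` at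
`q_m = Σ_i c_i λ_i^m` IS `finrank_S_expSum_eq_hankel` (the general law subsumes the exponential-sum law). -/
theorem Ecl_pow (lam : K) : ∀ k : ℕ, Ecl bV (fun m => lam ^ m) k = Eprod bV lam k
  | 0 => by rw [Ecl, Eprod, pow_zero, map_one]
  | k + 1 => by
    have hs : (fun m => lam ^ (m + 1)) = fun m => lam * (fun i => lam ^ i) m := by
      funext m; rw [pow_succ, mul_comm]
    rw [Ecl, hs, Ecl_smul, Ecl_pow lam k, Eprod, Efac, LM, ℓN, mN, add_mul, one_mul, mul_smul_comm, smul_mul_assoc]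

/-- `Ecl (m ↦ Σ_i c_i λ_i^m) k = Σ_i c_i • Eprod λ_i k` — the general law at an exponential-sum sequence is the exponential-sum law. -/
theorem Ecl_expSum {ι' : Type*} (s : Finset ι') (c lam : ι' → K) (k : ℕ) :
    Ecl bV (fun m => ∑ i ∈ s, c i * lam i ^ m) k = ∑ i ∈ s, c i • Eprod bV (lam i) k := by
  classical
  induction s using Finset.induction_on with
  | empty =>
    simp only [Finset.sum_empty]
    have : Ecl bV (fun _ => (0 : K)) k = 0 := by
      have h := Ecl_smul bV k (0 : K) (fun _ => (0 : K))
      simp only [zero_mul, zero_smul] at h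
      exact h
    exact this
  | insert i s hi ih =>
    simp only [Finset.sum_insert hi]
    have hs : (fun m => c i * lam i ^ m + ∑ i ∈ s, c i * lam i ^ m) =
        fun m => (fun j => c i * lam i ^ j) m + (fun j => ∑ i ∈ s, c i * lam i ^ j) m := rfl
    rw [hs, Ecl_add, ih, Ecl_smul, Ecl_pow]

/-- the general Hankel generator `gw q k` is homogeneous of `W`-degree `k`. -/
lemma gw_mem : ∀ (k : ℕ) (q : ℕ → K), gw bV q k ∈ ⋀[K]^k (W K (Lsp bV))
  | 0, q => by
    rw [gw, ExteriorAlgebra.exteriorPower, pow_zero, Algebra.algebraMap_eq_smul_one]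
    exact Submodule.smul_mem _ _ (Submodule.one_le.mp le_rfl)
  | k + 1, q => by
    rw [gw, ExteriorAlgebra.exteriorPower, pow_succ]
    exact Submodule.add_mem _ (Submodule.mul_mem_mul (gw_mem k q) (YN_mem bV k))
      (Submodule.mul_mem_mul (gw_mem k _) (XN_mem bV k))

/-- `dim S_k(Ecl q n) = dim range(θ ↦ θ ∧ gw q n)` (injectivity of `Φ_ω`). -/
theorem finrank_S_Ecl (q : ℕ → K) (k : ℕ) :
    Module.finrank K (S K (Lsp bV) k (Ecl bV q n)) =
      Module.finrank K (LinearMap.range (wedge K (Lsp bV) k (gw bV q n))) := by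
  rw [← Φ_gw]
  exact finrank_S_eq_of_injective (Φ_vacuum_injective bV) k _

end Summit.Ventures.HSemireg.WedgeBridge
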